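import Literature.Dynamics.SymbolicDynamics.Hochman2025Claims
import Literature.Dynamics.SymbolicDynamics.Hochman2025Tilt
import Mathlib.Order.Zorn
import HarnessLib

/-!
# Hochman 2025, §6.3 Steps C–D: the new frames near the boundary (geometry)

Continuation of `Hochman2025Kept.lean` / `Hochman2025Claims.lean` (§6.3 of M. Hochman,
*Irreducibility and periodicity in `ℤ²` symbolic systems*, Discrete Analysis 2025:17). At the
small levels the kept frames are not dense near the boundary between the two zones, and Steps C–D
add NEW frames there, whose boxes are built by Lemma 5.4 across a large connected piece of the
gap and whose witnesses are then chosen on that piece (hence at free sites). This file fixes the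
data of the construction (`Gluing.Setup`: the parameters, `J`, the two valid dense certificates)
and builds the GEOMETRY of the new frames:

* `Buildable D n u`: small level and a gap point `e` with `0.2 rₙ ≤ |e - u| ≤ 0.95 rₙ + 1`;
  `Admissible`: buildable and `rₙ/2`-far from the kept centres; **the new centres**
  `NewCentres D n`, a maximal `rₙ/2`-separated set of admissible points (Zorn; Step D's
  "iterate over all sites ... add a new frame" made order-free), and its maximality
  (`exists_newCentre_near`);
* at a buildable point: the gap continuum of `exists_gap_continuum` around `e` (radii `50` and
  `rₙ/100`) and the orientation `kOf` given by the tilt lemma `Plane.exists_tilt`, so that the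
  continuum `PsetOf` lies in the box zone of the frame and spans transversally a window of width
  `w₀ = 101 hₙ (Nₙ + S + 1)` starting at `m1Of` (`frameData_spec`) — Lemma 5.4;
* the `Nₙ + S + 1` candidate offsets `candT`, the **threat** of a candidate by a predetermined
  witness of a kept frame of higher level and the same orientation (within `1.2 rₙ`, transversally
  within `40 hₙ` of the candidate's centre line), the bound `≤ S` on the number of threatened
  candidates (`card_threat_le`: one threat per class `σ`, by Cor. 5.3 for the valid kept
  certificate — "`W_{>n}` contains at most one witness" per class, Step C), the choice `goodIdx` of
  `Nₙ` unthreatened candidates and the offsets `tsel`;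
* the geometric new frame `newGeom D n u` (centre `u`, orientation `kOf`, offsets `tsel`,
  provisional witnesses in section `0`), its well-formedness, and the *geometric certificate*
  `Cgeom D` = kept frames ∪ geometric new frames with `Cgeom_wf` (its obstacle families are those
  of the final certificate, which has the same frames with other witnesses).

## References

* [Hochman2025] M. Hochman, op. cit., Lemma 5.4 (p. 23) and §6.3 Steps C–D (pp. 33–35). Read via
  `lit read arxiv:2401.02273`.
-/

noncomputable section

open Set Metric Complex

namespace Literature.Dynamics.SymbolicDynamics

namespace Hochman2025

namespace Gluing

open scoped NNReal

/-! ### The data of the gluing -/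

/-- **The data of the gluing theorem**: good parameters, a finite non-empty `20`-chain-connected
set `J` (where `y` is glued) and the two valid dense certificates of `x` and `y`.
[cite: Hochman2025, §6.2 ("Let `x, y ∈ X` with compatible dense certificates `Cx, Cy`")] -/
structure Setup (P : Params) where
  /-- the parameter inequalities -/
  hP : P.Good
  /-- the glued set -/
  J : Finset (ℤ × ℤ)
  hJ : J.Nonempty
  hJc : ∀ p ∈ J, ∀ q ∈ J, Relation.ReflTransGen (ChainRel 20 (↑J : Set (ℤ × ℤ))) p q
  /-- the certificate of `x` -/
  Cx : Cert P
  /-- the certificate of `y` -/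
  Cy : Cert P
  hVx : Cx.Valid hP
  hVy : Cy.Valid hP
  hDx : Cx.Dense
  hDy : Cy.Dense

variable {P : Params} (D : Setup P)

namespace Setup

/-- The kept certificate of the data. [cite: Hochman2025, §6.3 Steps A–B] -/
def Ck : Cert P := Ckept D.hP D.J D.hVx D.hVy

/-- The kept certificate is valid. [cite: Hochman2025, §6.3 Steps A–B] -/
theorem Ck_valid : D.Ck.Valid D.hP := Ckept_valid D.hP D.hJ D.hVx D.hVy

/-- Numerical size of the radii: `rₙ ≥ 80000` for `n ≥ 1`. [folklore] -/
theorem r_ge (hP : P.Good) {n : ℕ} (hn : 1 ≤ n) : 80000 ≤ P.r n := by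
  have h1 := Params.h_le_r hP hn
  have h2 := Params.h_one_le hP hn
  have h3 := hP.h_one
  linarith

/-! ### Buildable points and the new centres (Step D, order-free) -/

/-- **Buildable points** of a small level: a gap point at distance between `0.2 rₙ` and
`0.95 rₙ + 1`. [cite: Hochman2025, §6.3 Step D ("`d(e, u') = ¾ rₙ`")] -/
def Buildable (n : ℕ) (u : ℂ) : Prop :=
  ¬ Large P D.J n ∧ ∃ e ∈ Gap D.J, 1 / 5 * P.r n ≤ ‖e - u‖ ∧ ‖e - u‖ ≤ 95 / 100 * P.r n + 1

/-- The centres of the kept frames of a level. [folklore] -/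
def KeptCentres (n : ℕ) : Set ℂ := {c | ∃ F ∈ D.Ck.frames n, F.c = c}

/-- **Admissible new centres**: buildable and `rₙ/2`-far from the kept centres.
[cite: Hochman2025, §6.3 Step D] -/
def Admissible (n : ℕ) : Set ℂ := {u | D.Buildable n u ∧ ∀ c ∈ D.KeptCentres n, P.r n / 2 ≤ ‖u - c‖}

/-- The separated admissible sets. [folklore] -/
def SepFamily (n : ℕ) : Set (Set ℂ) :=
  {S | S ⊆ D.Admissible n ∧ S.Pairwise fun u v => P.r n / 2 ≤ ‖u - v‖}

/-- A maximal separated admissible set exists (Zorn). [folklore] -/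
theorem exists_maximal_sep (n : ℕ) : ∃ m, Maximal (· ∈ D.SepFamily n) m := by
  refine zorn_subset (D.SepFamily n) fun c hc hchain => ⟨⋃₀ c, ⟨?_, ?_⟩, fun s hs => subset_sUnion_of_mem hs⟩
  · intro u hu
    obtain ⟨s, hs, hus⟩ := mem_sUnion.mp hu
    exact (hc hs).1 hus
  · intro u hu v hv huv
    obtain ⟨s, hs, hus⟩ := mem_sUnion.mp hu
    obtain ⟨s', hs', hvs'⟩ := mem_sUnion.mp hv
    rcases hchain.total hs hs' with h | h
    · exact (hc hs').2 (h hus) hvs' huv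
    · exact (hc hs).2 hus (h hvs') huv

/-- **The new centres** of a level: a maximal `rₙ/2`-separated set of admissible points.
[cite: Hochman2025, §6.3 Step D] -/
def NewCentres (n : ℕ) : Set ℂ := Classical.choose (D.exists_maximal_sep n)

/-- The new centres form a maximal separated admissible set. [folklore] -/
theorem newCentres_maximal (n : ℕ) : Maximal (· ∈ D.SepFamily n) (D.NewCentres n) :=
  Classical.choose_spec (D.exists_maximal_sep n)

/-- New centres are admissible. [folklore] -/
theorem newCentres_subset (n : ℕ) : D.NewCentres n ⊆ D.Admissible n := (D.newCentres_maximal n).1.1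

/-- New centres are `rₙ/2`-separated. [folklore] -/
theorem newCentres_sep (n : ℕ) : (D.NewCentres n).Pairwise fun u v => P.r n / 2 ≤ ‖u - v‖ :=
  (D.newCentres_maximal n).1.2

/-- **Maximality**: every admissible point is within `< rₙ/2` of a new centre.
[cite: Hochman2025, §6.3 Step D ("`u''` would already be `10rₙ`-close to `v`")] -/
theorem exists_newCentre_near {n : ℕ} {u : ℂ} (hu : u ∈ D.Admissible n) :
    ∃ v ∈ D.NewCentres n, ‖u - v‖ < P.r n / 2 := by
  by_contra hcon
  push Not at hcon
  have hmax := D.newCentres_maximal n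
  have hins : insert u (D.NewCentres n) ∈ D.SepFamily n := by
    refine ⟨?_, ?_⟩
    · rintro w (rfl | hw)
      · exact hu
      · exact D.newCentres_subset n hw
    · intro a ha b hb hab
      rcases ha with rfl | ha <;> rcases hb with rfl | hb
      · exact absurd rfl hab
      · exact hcon b hb
      · rw [← norm_neg, neg_sub]; exact hcon a ha
      · exact D.newCentres_sep n ha hb hab
  have hsub : D.NewCentres n ⊆ insert u (D.NewCentres n) := subset_insert _ _
  have heq := hmax.2 hins hsub
  have humem : u ∈ D.NewCentres n := heq (mem_insert _ _)
  have := hcon u humem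
  simp at this
  linarith [P.r_pos n]

/-- New centres lie at small levels. [folklore] -/
theorem not_large_of_newCentre {n : ℕ} {u : ℂ} (hu : u ∈ D.NewCentres n) : ¬ Large P D.J n :=
  (D.newCentres_subset n hu).1.1

/-! ### The gap continuum and the orientation at a buildable point (Lemma 5.4) -/

/-- The transverse window of a stack of `N + S + 1` boxes. [cite: Hochman2025, Lemma 5.4
("the projection of `E` in direction `u⊥` has length at least `1000 (Nₙ + 1) hₙ`")] -/
def w₀ (P : Params) (n : ℕ) : ℝ := 101 * P.h n * ((P.N n : ℝ) + P.S + 1)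

/-- `w₀ ≥ 0`. [folklore] -/
theorem w₀_nonneg (n : ℕ) : 0 ≤ w₀ P n := by unfold w₀; have := P.h_pos n; positivity

/-- `T w₀ ≤ rₙ / 100`. [cite: Hochman2025, §5.2 (`rₙ ≫ hₙ, Nₙ`)] -/
theorem T_mul_w₀_le (hP : P.Good) (n : ℕ) : (P.T : ℝ) * w₀ P n ≤ P.r n / 100 := by
  have h := hP.stack_fit n
  have hT : (0 : ℝ) < P.T := by exact_mod_cast lt_of_lt_of_le (by norm_num) hP.T_le
  unfold w₀
  rw [le_div_iff₀ (by positivity)] at h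
  rw [le_div_iff₀ (by norm_num)]
  nlinarith

/-- **Lemma 5.4 at a buildable point**: an orientation `k`, a connected subset `Pset` of the gap
inside the box zone of the frame `(orient k, u)`, and a transverse window `[m₁, m₁ + w₀]`
spanned by `Pset` inside the band `[-r/25, r/25]`. [cite: Hochman2025, Lemma 5.4 and §6.3 Step C] -/
theorem exists_frameData {n : ℕ} (hn : 1 ≤ n) {u : ℂ} (hB : D.Buildable n u) :
    ∃ (k : Fin P.T) (Pset : Set ℂ) (m₁ : ℝ),
      Pset ⊆ Gap D.J ∧ IsPreconnected Pset ∧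
      (∀ p ∈ Pset, -(99 / 100 * P.r n) ≤ (Plane.coords (Plane.orient P.T k) u p).1 ∧
        (Plane.coords (Plane.orient P.T k) u p).1 ≤ -(P.r n / 10)) ∧
      -(P.r n / 25) ≤ m₁ ∧ m₁ + w₀ P n ≤ P.r n / 25 ∧
      (∃ p ∈ Pset, (Plane.coords (Plane.orient P.T k) u p).2 ≤ m₁) ∧
      (∃ p ∈ Pset, m₁ + w₀ P n ≤ (Plane.coords (Plane.orient P.T k) u p).2) ∧
      (∀ p ∈ Pset, ‖p - u‖ ≤ P.r n) := by
  obtain ⟨hSm, e, he, hd1, hd2⟩ := hB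
  have hr := r_ge D.hP hn
  have hrpos := P.r_pos n
  -- the gap continuum around `e`
  have hdiam : 2 * (P.r n / 100) + 130 ≤ (ldiam D.J : ℝ) := by
    have := ldiam_ge_of_not_large hSm; linarith
  obtain ⟨Pset, hPgap, hPc, hPconn, hPann, ⟨p₀, hp₀, hp₀e⟩, ⟨q, hq, hqe⟩⟩ :=
    exists_gap_continuum D.hJ D.hJc he (R := P.r n / 100) (by linarith) hdiam
  -- distances
  have hpe : ∀ p ∈ Pset, ‖p - e‖ ≤ P.r n / 100 := fun p hp => by
    rw [← Complex.dist_eq]; exact (hPann p hp).2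
  have hp₀e' : ‖p₀ - e‖ = 50 := by rw [← Complex.dist_eq]; exact hp₀e
  have hqe' : ‖q - e‖ = P.r n / 100 := by rw [← Complex.dist_eq]; exact hqe
  have hPp₀ : ∀ p ∈ Pset, ‖p - p₀‖ ≤ 11 / 1000 * P.r n := by
    intro p hp
    have h1 := hpe p hp
    have h2 : ‖p - p₀‖ ≤ ‖p - e‖ + ‖p₀ - e‖ := by
      have := norm_sub_le (p - e) (p₀ - e)
      rwa [show p - e - (p₀ - e) = p - p₀ by ring] at this
    linarith
  have hqp₀ : 9 / 1000 * P.r n ≤ ‖q - p₀‖ := by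
    have h2 : ‖q - e‖ ≤ ‖q - p₀‖ + ‖p₀ - e‖ := by
      have := norm_add_le (q - p₀) (p₀ - e)
      rwa [show q - p₀ + (p₀ - e) = q - e by ring] at this
    linarith
  have hdp₀1 : 3 / 20 * P.r n ≤ ‖p₀ - u‖ := by
    have h2 : ‖e - u‖ ≤ ‖p₀ - u‖ + ‖p₀ - e‖ := by
      have := norm_sub_le (p₀ - u) (p₀ - e)
      rwa [show p₀ - u - (p₀ - e) = e - u by ring] at this
    linarith
  have hdp₀2 : ‖p₀ - u‖ ≤ 39 / 40 * P.r n := by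
    have h2 : ‖p₀ - u‖ ≤ ‖p₀ - e‖ + ‖e - u‖ := by
      have := norm_add_le (p₀ - e) (e - u)
      rwa [show p₀ - e + (e - u) = p₀ - u by ring] at this
    linarith
  -- tilt
  obtain ⟨k, hzone, hsep⟩ := Plane.exists_tilt D.hP.T_le hrpos hdp₀1 hdp₀2 hPp₀ hqp₀ (w₀_nonneg n)
    (T_mul_w₀_le D.hP n)
  set v := Plane.orient P.T k with hv
  set yq := (Plane.coords v u q).2 with hyq
  set y₀ := (Plane.coords v u p₀).2 with hy₀
  refine ⟨k, Pset, min yq y₀, hPgap, hPconn, fun p hp => ⟨(hzone p hp).1, (hzone p hp).2.1⟩, ?_, ?_, ?_, ?_, ?_⟩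
  · have h1 := (hzone q hq).2.2
    have h2 := (hzone p₀ hp₀).2.2
    rw [abs_le] at h1 h2
    exact le_min h1.1 h2.1
  · have h1 := (hzone q hq).2.2
    have h2 := (hzone p₀ hp₀).2.2
    rw [abs_le] at h1 h2
    rcases le_total yq y₀ with h | h
    · rw [min_eq_left h]
      rw [abs_of_nonpos (by linarith)] at hsep
      linarith
    · rw [min_eq_right h]
      rw [abs_of_nonneg (by linarith)] at hsep
      linarith
  · rcases le_total yq y₀ with h | h
    · exact ⟨q, hq, by rw [min_eq_left h]⟩
    · exact ⟨p₀, hp₀, by rw [min_eq_right h]⟩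
  · rcases le_total yq y₀ with h | h
    · refine ⟨p₀, hp₀, ?_⟩
      rw [min_eq_left h]
      rw [abs_of_nonpos (by linarith)] at hsep
      change yq + w₀ P n ≤ y₀; linarith
    · refine ⟨q, hq, ?_⟩
      rw [min_eq_right h]
      rw [abs_of_nonneg (by linarith)] at hsep
      change y₀ + w₀ P n ≤ yq; linarith
  · intro p hp
    have h1 := hPp₀ p hp
    have : ‖p - u‖ ≤ ‖p - p₀‖ + ‖p₀ - u‖ := by
      have := norm_add_le (p - p₀) (p₀ - u)
      rwa [show p - p₀ + (p₀ - u) = p - u by ring] at this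
    linarith

/-- New centres are buildable. [folklore] -/
theorem buildable_of_newCentre {n : ℕ} {u : ℂ} (hu : u ∈ D.NewCentres n) : D.Buildable n u :=
  (D.newCentres_subset n hu).1

section FrameData

variable {D} {n : ℕ} (hn : 1 ≤ n) {u : ℂ} (hB : D.Buildable n u)

/-- The orientation of the new frame at a buildable point. [cite: Hochman2025, Lemma 5.4] -/
def kOf : Fin P.T := Classical.choose (D.exists_frameData hn hB)

/-- The gap continuum crossing the boxes of the new frame. [cite: Hochman2025, §6.3 Step C (`Ê'`)] -/
def PsetOf : Set ℂ := Classical.choose (Classical.choose_spec (D.exists_frameData hn hB))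

/-- The lower end of the transverse window. [cite: Hochman2025, Lemma 5.4] -/
def m1Of : ℝ := Classical.choose (Classical.choose_spec (Classical.choose_spec (D.exists_frameData hn hB)))

/-- The properties of the frame data. [cite: Hochman2025, Lemma 5.4] -/
theorem frameData_spec :
    PsetOf hn hB ⊆ Gap D.J ∧ IsPreconnected (PsetOf hn hB) ∧
      (∀ p ∈ PsetOf hn hB, -(99 / 100 * P.r n) ≤ (Plane.coords (Plane.orient P.T (kOf hn hB)) u p).1 ∧
        (Plane.coords (Plane.orient P.T (kOf hn hB)) u p).1 ≤ -(P.r n / 10)) ∧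
      -(P.r n / 25) ≤ m1Of hn hB ∧ m1Of hn hB + w₀ P n ≤ P.r n / 25 ∧
      (∃ p ∈ PsetOf hn hB, (Plane.coords (Plane.orient P.T (kOf hn hB)) u p).2 ≤ m1Of hn hB) ∧
      (∃ p ∈ PsetOf hn hB, m1Of hn hB + w₀ P n ≤ (Plane.coords (Plane.orient P.T (kOf hn hB)) u p).2) ∧
      (∀ p ∈ PsetOf hn hB, ‖p - u‖ ≤ P.r n) :=
  Classical.choose_spec (Classical.choose_spec (Classical.choose_spec (D.exists_frameData hn hB)))

end FrameData

/-! ### Candidate offsets, threats, and the choice of `N` unthreatened boxes (Step C) -/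

/-- The candidate offsets `tᵢ = m₁ + 101 hₙ i`. [cite: Hochman2025, Lemma 5.4 (2)] -/
def candT (P : Params) (n : ℕ) (m₁ : ℝ) (i : ℕ) : ℝ := m₁ + 101 * P.h n * i

/-- **A candidate box is threatened** by a predetermined witness of a kept frame of higher level
and the same orientation that lies within `1.2 rₙ` of the new centre and transversally within
`40 hₙ` of the candidate's centre line. [cite: Hochman2025, §6.3 Step C ("Let `W_{>n}` denote the
set of witnesses `w ∈ C` whose level is greater than `n` and such that `w ∈ 20S` ...")] -/
def Threat (n : ℕ) (u : ℂ) (k : Fin P.T) (m₁ : ℝ) (i : ℕ) : Prop :=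
  ∃ m, n < m ∧ ∃ F ∈ D.Ck.frames m, F.k = k ∧ ∃ j : Fin (P.N m), ‖F.w j - u‖ ≤ 6 / 5 * P.r n ∧
    |(Plane.coords (Plane.orient P.T k) u (F.w j)).2 - (candT P n m₁ i + P.h n / 2)| ≤ 40 * P.h n

/-- Two distinct predetermined witnesses of the same class at levels `> n` are more than
`2.4 rₙ` apart (Cor. 5.3 for the valid kept certificate). [cite: Hochman2025, §6.3 Step C ("by
Lemma 5.2, the witnesses at levels `> n` are `hₙ₊₁`-separated")] -/
theorem far_of_same_class {n m m' : ℕ} (hm : n < m) (hm' : n < m') {F : Frame P m} (hF : F ∈ D.Ck.frames m)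
    {F' : Frame P m'} (hF' : F' ∈ D.Ck.frames m') (hk : F'.k = F.k) {j : Fin (P.N m)} {j' : Fin (P.N m')}
    (hσ : F.σ j = F'.σ j') (hne : (⟨m, F, j⟩ : Σ m, Frame P m × Fin (P.N m)) ≠ ⟨m', F', j'⟩) :
    12 / 5 * P.r n < ‖F.w j - F'.w j'‖ := by
  have hP := D.hP
  have hV := D.Ck_valid
  have hrn := P.r_pos n
  rcases lt_trichotomy m m' with hlt | rfl | hgt
  · have h1 := (Cert.cor_5_3_levels hP hV (by omega) hlt hF hF' hk j j' hσ).1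
    have h2 : 2000 * P.r n ≤ P.h m := by
      have := hP.r_le_h (m - 1)
      have hm1 : m - 1 + 1 = m := by omega
      rw [hm1] at this
      exact le_trans (by nlinarith [Params.r_mono hP (show n ≤ m - 1 by omega)]) this
    linarith
  · by_cases hFF : F = F'
    · subst hFF
      have hjj : j ≠ j' := by
        intro hjj; apply hne; subst hjj; rfl
      have h1 := Cert.cor_5_3_same_frame hP hV.wf hF hjj
      have h2 : 2000 * P.r n ≤ P.h m := by
        have := hP.r_le_h (m - 1)
        have hm1 : m - 1 + 1 = m := by omega
        rw [hm1] at this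
        exact le_trans (by nlinarith [Params.r_mono hP (show n ≤ m - 1 by omega)]) this
      linarith
    · have h1 := Cert.cor_5_3_same_level hP hV.wf hF hF' hFF hk hσ
      have h2 : P.r n ≤ P.r m / 10000 := by
        have := Params.r_lt_le hP n
        have := Params.r_mono hP (show n + 1 ≤ m by omega)
        linarith
      linarith
  · have h1 := (Cert.cor_5_3_levels hP hV (by omega) hgt hF' hF hk.symm j' j hσ.symm).2
    have h2 : 2000 * P.r n ≤ P.h m' := by
      have := hP.r_le_h (m' - 1)
      have hm1 : m' - 1 + 1 = m' := by omega
      rw [hm1] at this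
      exact le_trans (by nlinarith [Params.r_mono hP (show n ≤ m' - 1 by omega)]) this
    linarith

open Classical in
/-- **At most `S` candidates are threatened** (a threatening witness determines its class `σ`;
two threats of the same class would be two predetermined witnesses of the same class within
`2.4 rₙ` of each other, or one witness within `80 hₙ` of two candidate lines `≥ 101 hₙ` apart).
[cite: Hochman2025, §6.3 Step C ("`W_{>n}` contains at most one witness ... If there is an
exceptional one, throw it out")] -/
theorem card_threat_le (n : ℕ) (u : ℂ) (k : Fin P.T) (m₁ : ℝ) (M : ℕ) :
    ((Finset.range M).filter fun i => D.Threat n u k m₁ i).card ≤ P.S := by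
  set T := (Finset.range M).filter fun i => D.Threat n u k m₁ i with hT
  by_contra hlt
  push Not at hlt
  -- the class of a threatening witness
  have hch : ∀ i ∈ T, ∃ σ : Fin P.S, ∃ m, n < m ∧ ∃ F ∈ D.Ck.frames m, F.k = k ∧ ∃ j : Fin (P.N m),
      F.σ j = σ ∧ ‖F.w j - u‖ ≤ 6 / 5 * P.r n ∧
      |(Plane.coords (Plane.orient P.T k) u (F.w j)).2 - (candT P n m₁ i + P.h n / 2)| ≤ 40 * P.h n := by
    intro i hi
    obtain ⟨m, hm, F, hF, hk, j, h1, h2⟩ := (Finset.mem_filter.mp hi).2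
    exact ⟨F.σ j, m, hm, F, hF, hk, j, rfl, h1, h2⟩
  haveI : Nonempty (Fin P.S) := ⟨⟨0, lt_of_lt_of_le (by norm_num) D.hP.S_le⟩⟩
  choose! cls hcls using hch
  have hmaps : Set.MapsTo cls T (Finset.univ : Finset (Fin P.S)) := fun i _ => Finset.mem_univ _
  have hcard : (Finset.univ : Finset (Fin P.S)).card < T.card := by simpa using hlt
  obtain ⟨i, hi, i', hi', hii', heq⟩ := Finset.exists_ne_map_eq_of_card_lt_of_maps_to hcard hmaps
  obtain ⟨m, hm, F, hF, hk, j, hσ, hd, hy⟩ := hcls i hi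
  obtain ⟨m', hm', F', hF', hk', j', hσ', hd', hy'⟩ := hcls i' hi'
  have hh := P.h_pos n
  have hrn := P.r_pos n
  -- same witness or different
  by_cases hsame : (⟨m, F, j⟩ : Σ m, Frame P m × Fin (P.N m)) = ⟨m', F', j'⟩
  · -- the same witness threatens two candidate lines `≥ 101 h` apart: impossible
    have hm_eq : m = m' := congrArg Sigma.fst hsame
    subst hm_eq
    have hFj : (F, j) = (F', j') := eq_of_heq (Sigma.mk.inj hsame).2
    have hF_eq : F = F' := congrArg Prod.fst hFj
    have hj_eq : j = j' := congrArg Prod.snd hFj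
    subst hF_eq; subst hj_eq
    have hdiff : |candT P n m₁ i - candT P n m₁ i'| ≤ 80 * P.h n := by
      have := abs_sub_le (candT P n m₁ i + P.h n / 2) ((Plane.coords (Plane.orient P.T k) u (F.w j)).2)
        (candT P n m₁ i' + P.h n / 2)
      rw [abs_sub_comm] at hy
      rw [show candT P n m₁ i + P.h n / 2 - (candT P n m₁ i' + P.h n / 2) = candT P n m₁ i - candT P n m₁ i' by ring] at this
      linarith
    have hii : (1 : ℝ) ≤ |(i : ℝ) - i'| := by
      rcases Nat.lt_or_gt_of_ne hii' with h | h
      · have : (i : ℝ) + 1 ≤ i' := by exact_mod_cast h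
        rw [abs_of_neg (by linarith)]; linarith
      · have : (i' : ℝ) + 1 ≤ i := by exact_mod_cast h
        rw [abs_of_pos (by linarith)]; linarith
    have : |candT P n m₁ i - candT P n m₁ i'| = 101 * P.h n * |(i : ℝ) - i'| := by
      simp only [candT]
      rw [show m₁ + 101 * P.h n * i - (m₁ + 101 * P.h n * i') = 101 * P.h n * ((i : ℝ) - i') by ring,
        abs_mul, abs_of_pos (by positivity)]
    rw [this] at hdiff
    nlinarith
  · -- two different witnesses of the same class within `2.4 rₙ`: contradicts Cor 5.3
    have hfar := D.far_of_same_class hm hm' hF hF' (by rw [hk, hk']) (by rw [hσ, hσ', heq]) hsame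
    have : ‖F.w j - F'.w j'‖ ≤ ‖F.w j - u‖ + ‖F'.w j' - u‖ := by
      have := norm_sub_le (F.w j - u) (F'.w j' - u)
      rwa [show F.w j - u - (F'.w j' - u) = F.w j - F'.w j' by ring] at this
    linarith

/-- The unthreatened candidates among the first `N + S + 1`. [cite: Hochman2025, §6.3 Step C] -/
def goodSet (n : ℕ) (u : ℂ) (k : Fin P.T) (m₁ : ℝ) : Finset ℕ := by
  classical
  exact (Finset.range (P.N n + P.S + 1)).filter fun i => ¬ D.Threat n u k m₁ i

/-- **At least `N` candidates are unthreatened.** [cite: Hochman2025, §6.3 Step C ("We are left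
with at least `Nₙ` good rectangles")] -/
theorem N_le_card_goodSet (n : ℕ) (u : ℂ) (k : Fin P.T) (m₁ : ℝ) : P.N n ≤ (D.goodSet n u k m₁).card := by
  classical
  have h1 := D.card_threat_le n u k m₁ (P.N n + P.S + 1)
  have h2 := Finset.card_filter_add_card_filter_not (s := Finset.range (P.N n + P.S + 1))
    (fun i => D.Threat n u k m₁ i)
  rw [Finset.card_range] at h2
  unfold goodSet
  omega

/-- Members of the good set are unthreatened candidates. [folklore] -/
theorem mem_goodSet {n : ℕ} {u : ℂ} {k : Fin P.T} {m₁ : ℝ} {i : ℕ} :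
    i ∈ D.goodSet n u k m₁ ↔ i < P.N n + P.S + 1 ∧ ¬ D.Threat n u k m₁ i := by
  classical
  unfold goodSet
  simp [Finset.mem_filter, Finset.mem_range]

/-- **The chosen candidate indices** of the `N` new boxes (an injection into the good set).
[cite: Hochman2025, §6.3 Step C] -/
def goodIdx (n : ℕ) (u : ℂ) (k : Fin P.T) (m₁ : ℝ) (j : Fin (P.N n)) : ℕ :=
  (D.goodSet n u k m₁).orderEmbOfFin rfl (Fin.castLE (D.N_le_card_goodSet n u k m₁) j)

/-- The chosen indices are good. [folklore] -/
theorem goodIdx_mem (n : ℕ) (u : ℂ) (k : Fin P.T) (m₁ : ℝ) (j : Fin (P.N n)) :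
    D.goodIdx n u k m₁ j ∈ D.goodSet n u k m₁ :=
  Finset.orderEmbOfFin_mem _ _ _

/-- The chosen indices are distinct. [folklore] -/
theorem goodIdx_injective (n : ℕ) (u : ℂ) (k : Fin P.T) (m₁ : ℝ) : Function.Injective (D.goodIdx n u k m₁) := by
  intro j j' h
  have := ((D.goodSet n u k m₁).orderEmbOfFin rfl).injective h
  exact Fin.castLE_injective _ this

/-- The offsets of the `N` new boxes. [cite: Hochman2025, Lemma 5.4 (2)] -/
def tsel (n : ℕ) (u : ℂ) (k : Fin P.T) (m₁ : ℝ) (j : Fin (P.N n)) : ℝ := candT P n m₁ (D.goodIdx n u k m₁ j)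

/-- The offsets lie in the window `[m₁, m₁ + w₀ - h]`. [folklore] -/
theorem tsel_mem (n : ℕ) (u : ℂ) (k : Fin P.T) (m₁ : ℝ) (j : Fin (P.N n)) :
    m₁ ≤ D.tsel n u k m₁ j ∧ D.tsel n u k m₁ j + P.h n ≤ m₁ + w₀ P n := by
  have hi := (D.mem_goodSet.mp (D.goodIdx_mem n u k m₁ j)).1
  have hh := P.h_pos n
  unfold tsel candT w₀
  set i := D.goodIdx n u k m₁ j
  have hi' : (i : ℝ) + 1 ≤ (P.N n : ℝ) + P.S + 1 := by
    have : i + 1 ≤ P.N n + P.S + 1 := hi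
    exact_mod_cast this
  constructor
  · have : (0 : ℝ) ≤ 101 * P.h n * i := by positivity
    linarith
  · nlinarith

/-- Distinct new boxes have offsets `≥ 101 h` apart. [cite: Hochman2025, Lemma 5.4 (2)] -/
theorem tsel_apart (n : ℕ) (u : ℂ) (k : Fin P.T) (m₁ : ℝ) {j j' : Fin (P.N n)} (hjj' : j ≠ j') :
    101 * P.h n ≤ |D.tsel n u k m₁ j - D.tsel n u k m₁ j'| := by
  have hne : D.goodIdx n u k m₁ j ≠ D.goodIdx n u k m₁ j' := fun h => hjj' (D.goodIdx_injective n u k m₁ h)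
  have hh := P.h_pos n
  unfold tsel candT
  set i := D.goodIdx n u k m₁ j
  set i' := D.goodIdx n u k m₁ j'
  rw [show m₁ + 101 * P.h n * i - (m₁ + 101 * P.h n * i') = 101 * P.h n * ((i : ℝ) - i') by ring, abs_mul,
    abs_of_pos (by positivity)]
  have hii : (1 : ℝ) ≤ |(i : ℝ) - i'| := by
    rcases Nat.lt_or_gt_of_ne hne with h | h
    · have : (i : ℝ) + 1 ≤ i' := by exact_mod_cast h
      rw [abs_of_neg (by linarith)]; linarith
    · have : (i' : ℝ) + 1 ≤ i := by exact_mod_cast h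
      rw [abs_of_pos (by linarith)]; linarith
  nlinarith

/-! ### The geometric new frames and the geometric certificate -/

section NewGeom

variable {D}

/-- The section index `0`. [folklore] -/
def sec0 (hP : P.Good) : Fin P.S := ⟨0, lt_of_lt_of_le (by norm_num) hP.S_le⟩

/-- **The geometric new frame** at a new centre (small level `n ≥ 1`): centre `u`, the
orientation and offsets of Lemma 5.4 / Step C, provisional witnesses at the centre of section `0`
of each box (they are replaced by gap points in `Hochman2025NewWitnesses.lean`; the obstacle
families only see the geometry). [cite: Hochman2025, §6.3 Steps C–D] -/
def newGeom {n : ℕ} (hn : 1 ≤ n) (u : ℂ) (hB : D.Buildable n u) : Frame P n where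
  c := u
  k := kOf hn hB
  t := D.tsel n u (kOf hn hB) (m1Of hn hB)
  w j := u + Plane.orient P.T (kOf hn hB) *
    (((-(P.r n / 10) - P.ℓ n / 2 : ℝ) : ℂ) + ((D.tsel n u (kOf hn hB) (m1Of hn hB) j + P.h n / 2 : ℝ) : ℂ) * I)
  σ _ := sec0 D.hP

/-- The band condition of the new boxes. [cite: Hochman2025, Lemma 5.4 (1)] -/
theorem newGeom_band {n : ℕ} (hn : 1 ≤ n) (u : ℂ) (hB : D.Buildable n u) (j : Fin (P.N n)) :
    |(newGeom hn u hB).t j| ≤ P.r n / 25 ∧ |(newGeom hn u hB).t j + P.h n| ≤ P.r n / 25 := by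
  obtain ⟨-, -, -, hm1, hm2, -, -, -⟩ := frameData_spec hn hB
  obtain ⟨h1, h2⟩ := D.tsel_mem n u (kOf hn hB) (m1Of hn hB) j
  have hh := P.h_pos n
  change |D.tsel n u (kOf hn hB) (m1Of hn hB) j| ≤ _ ∧ |D.tsel n u (kOf hn hB) (m1Of hn hB) j + P.h n| ≤ _
  constructor <;> (rw [abs_le]; constructor <;> linarith)

/-- The geometric new frame is well formed. [cite: Hochman2025, §6.3 Step C] -/
theorem newGeom_wf {n : ℕ} (hn : 1 ≤ n) (u : ℂ) (hB : D.Buildable n u) : (newGeom hn u hB).WF where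
  band := newGeom_band hn u hB
  apart j j' hjj' := D.tsel_apart n u (kOf hn hB) (m1Of hn hB) hjj'
  wit j := by
    set G := newGeom hn u hB with hG
    have hφ : G.φ (G.w j) = (-(P.r n / 10) - P.ℓ n / 2, G.t j + P.h n / 2) := by
      have := G.φ_add_mul (((-(P.r n / 10) - P.ℓ n / 2 : ℝ) : ℂ) +
        ((D.tsel n u (kOf hn hB) (m1Of hn hB) j + P.h n / 2 : ℝ) : ℂ) * I)
      simp only [Complex.add_re, Complex.ofReal_re, Complex.mul_re, Complex.I_re, Complex.ofReal_im,
        Complex.I_im, mul_zero, mul_one, sub_zero, add_zero, Complex.add_im, Complex.mul_im, zero_add] at this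
      exact this
    have hℓ := Params.ℓ_pos D.hP n
    have hh := P.h_pos n
    have hℓ' : 89 / 100 * P.r n / P.S = P.ℓ n := rfl
    change G.w j ∈ Plane.section_ G.v G.c (P.r n) (P.h n) (G.t j) P.S (sec0 D.hP)
    refine ⟨?_, ?_, ?_, ?_⟩
    · change -(P.r n / 10) - (((sec0 D.hP : ℕ) : ℝ) + 1) * (89 / 100 * P.r n / P.S) ≤ (G.φ (G.w j)).1
      rw [hφ, hℓ']; simp [sec0]; linarith
    · change (G.φ (G.w j)).1 ≤ -(P.r n / 10) - ((sec0 D.hP : ℕ) : ℝ) * (89 / 100 * P.r n / P.S)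
      rw [hφ, hℓ']; simp [sec0]; linarith
    · change G.t j ≤ (G.φ (G.w j)).2
      rw [hφ]; simp; linarith
    · change (G.φ (G.w j)).2 ≤ G.t j + P.h n
      rw [hφ]; simp; linarith

variable (D)

/-- **The geometric certificate**: kept frames and geometric new frames at the new centres.
[cite: Hochman2025, §6.3 Steps A–D] -/
def Cgeom : Cert P where
  frames n := D.Ck.frames n ∪ {F | ∃ (hn : 1 ≤ n) (u : ℂ) (hu : u ∈ D.NewCentres n),
    F = newGeom hn u (D.buildable_of_newCentre hu)}

variable {D}

/-- Membership in the geometric certificate. [folklore] -/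
theorem mem_Cgeom {n : ℕ} {F : Frame P n} :
    F ∈ D.Cgeom.frames n ↔ F ∈ D.Ck.frames n ∨
      ∃ (hn : 1 ≤ n) (u : ℂ) (hu : u ∈ D.NewCentres n), F = newGeom hn u (D.buildable_of_newCentre hu) :=
  Iff.rfl

/-- **The geometric certificate is structurally well formed.** New centres are `rₙ/2`-far from
kept centres (admissibility) and from each other (separation). [cite: Hochman2025, §6.3 Steps C–D
("adding frames with these centers does not violate the `rₙ/2` separation condition")] -/
theorem Cgeom_wf : D.Cgeom.WF := by
  have hkw := (D.Ck_valid).wf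
  refine ⟨fun n F hF => ?_, fun n F hF F' hF' hne => ?_⟩
  · rcases mem_Cgeom.mp hF with hF | ⟨hn, u, hu, rfl⟩
    · exact hkw.frame n F hF
    · exact newGeom_wf hn u _
  · rcases mem_Cgeom.mp hF with hF | ⟨hn, u, hu, rfl⟩ <;> rcases mem_Cgeom.mp hF' with hF' | ⟨hn', u', hu', rfl⟩
    · exact hkw.sep n F hF F' hF' hne
    · have := (D.newCentres_subset n hu').2 F.c ⟨F, hF, rfl⟩
      change P.r n / 2 ≤ ‖F.c - u'‖
      rw [← norm_neg, neg_sub]; exact this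
    · exact (D.newCentres_subset n hu).2 F'.c ⟨F', hF', rfl⟩
    · have huu' : u ≠ u' := by rintro rfl; exact hne rfl
      exact D.newCentres_sep n hu hu' huu'

/-- Kept frames are frames of the geometric certificate. [folklore] -/
theorem mem_Cgeom_of_mem_Ck {n : ℕ} {F : Frame P n} (hF : F ∈ D.Ck.frames n) : F ∈ D.Cgeom.frames n :=
  Or.inl hF

/-- Geometric new frames are frames of the geometric certificate. [folklore] -/
theorem newGeom_mem_Cgeom {n : ℕ} (hn : 1 ≤ n) {u : ℂ} (hu : u ∈ D.NewCentres n) :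
    newGeom hn u (D.buildable_of_newCentre hu) ∈ D.Cgeom.frames n :=
  Or.inr ⟨hn, u, hu, rfl⟩

end NewGeom

end Setup

end Gluing

end Hochman2025

end Literature.Dynamics.SymbolicDynamics
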